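import Mathlib.GroupTheory.Perm.Fin
import Mathlib.Algebra.BigOperators.Group.Finset.Powerset
import Mathlib.Data.Nat.Choose.Sum
import Mathlib.Data.Real.Basic
import Mathlib.Tactic
import HarnessLib

/-!
# Spitzer's combinatorial lemma (summed form) and the Rudnick–Sarnak spread identity

For a real vector `x = (x_0, …, x_{n-1})` and a permutation `σ` of the indices let
`s_t(σx) = x_{σ 0} + ⋯ + x_{σ (t-1)}` (`t = 0, …, n`) be the partial sums of the rearranged
vector and `S(σx) = max(0, s_1(σx), …, s_n(σx)) = max_{0 ≤ t ≤ n} s_t(σx)` (`maxPre (x ∘ σ)`).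
**Spitzer's combinatorial lemma** (F. Spitzer, Trans. AMS 82 (1956), Theorem 2.2) says that the
multiset `{S(σx) : σ ∈ S_n}` coincides with the multiset `{T(τx) : τ ∈ S_n}`,
`T(τx) = ∑_{cycles C of τ} (∑_{i ∈ C} x_i)⁺`. We prove its *summed* form, with the number
`(|A| - 1)! (n - |A|)!` of permutations having a prescribed set `A` as a cycle made explicit:

* `sum_perm_maxPre` : `∑_σ S(σx) = ∑_{A ⊆ [n]} (|A|-1)! (n-|A|)! (∑_{i∈A} x_i)⁺`

(the empty set contributes `0`). This is the identity (4.41) of Rudnick–Sarnak (Duke Math. J.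
81 (1996), p. 314, there derived "by adapting Spitzer's combinatorial method"). From it, the
reversal symmetry `∑_σ max_t s_t = -∑_σ min_t s_t` for zero-sum vectors ((4.37) loc. cit.) and
the pairing of a set with its complement ((4.42) loc. cit.) we deduce the identity behind
Rudnick–Sarnak's Proposition 4.3 in its linear-order form ((4.35)–(4.36), (4.43)):

* `sum_perm_spread_eq` : if `∑ x_i = 0` then
  `∑_σ V(σx) = (n/2) ∑_{A ⊆ [n]} (|A|-1)! (n-|A|-1)! |∑_{i∈A} x_i|`,
  `V = max_t s_t - min_t s_t` the spread ("maximal deviation") of the walk with steps `x_{σ i}`.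

## Proof

Not Spitzer's bijective proof but a short induction, run on `F(x) = ∑_σ min_t r_t(σx)` with
`r_t` the suffix sums: both `F` and the closed form `G(x) = -∑_A (|A|-1)!(n-|A|)! (∑_A x)⁻`
satisfy (i) `H_{n+1}(x) = ∑_p H_n(x|_{[n+1]∖p})` when `∑ x_i ≥ 0` (the full suffix does not
compete for the minimum; permutations decomposed by their first entry,
`Equiv.Perm.decomposeFin`) and (ii) `H(x) = n!·∑x_i + H(-x)` (reversal of the order), and
(i)–(ii) determine `H` by induction on `n`.

## Contents

* `preSum`, `sufSum`, `maxPre` (`= S`), `minSuf`, `maxSuf`; elementary relations.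
* `sum_perm_maxPre` (Spitzer, summed), `sum_perm_maxPre_add` (`∑_σ (S(σx) + S(-σx))`),
  `sum_perm_spread_eq` (Rudnick–Sarnak (4.35) for linear orders).

## References

* F. Spitzer, *A combinatorial lemma and its application to probability theory*, Trans. Amer.
  Math. Soc. 82 (1956), 323–339, Theorem 2.2.
* Z. Rudnick, P. Sarnak, *Zeros of principal `L`-functions and random matrix theory*, Duke
  Math. J. 81 (1996), 269–322, (4.29)–(4.43).
-/

noncomputable section

open Finset Equiv

namespace Literature.Combinatorics.Enumerative

namespace Spitzer

variable {n : ℕ}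

/-! ## Partial sums and their extrema -/

/-- The prefix sum `s_t(x) = x_0 + ⋯ + x_{t-1}` (`t = 0, …, n`; constant `= ∑ x` for `t ≥ n`).
[cite: Spitzer1956, (2.2)] -/
def preSum (x : Fin n → ℝ) (t : ℕ) : ℝ := ∑ i ∈ univ.filter (fun i : Fin n ↦ (i : ℕ) < t), x i

/-- The suffix sum `r_t(x) = x_t + ⋯ + x_{n-1}` (`= 0` for `t ≥ n`). [folklore] -/
def sufSum (x : Fin n → ℝ) (t : ℕ) : ℝ := ∑ i ∈ univ.filter (fun i : Fin n ↦ t ≤ (i : ℕ)), x i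

/-- Spitzer's functional `S(x) = max(0, s_1, …, s_n) = max_{0 ≤ t ≤ n} s_t(x)` (the empty prefix
`s_0 = 0` included); Rudnick–Sarnak's `M(O)` up to the harmless inclusion of `0` (for zero-sum
vectors `s_n = 0` anyway). [cite: Spitzer1956, (2.2)] -/
def maxPre (x : Fin n → ℝ) : ℝ := (range (n + 1)).sup' ⟨0, by simp⟩ (preSum x)

/-- `min_{0 ≤ t ≤ n} r_t(x)`, the minimum of the suffix sums (`≤ 0`, the empty suffix included).
[folklore] -/
def minSuf (x : Fin n → ℝ) : ℝ := (range (n + 1)).inf' ⟨0, by simp⟩ (sufSum x)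

/-- `max_{0 ≤ t ≤ n} r_t(x)`, the maximum of the suffix sums. [folklore] -/
def maxSuf (x : Fin n → ℝ) : ℝ := (range (n + 1)).sup' ⟨0, by simp⟩ (sufSum x)

/-- `s_t + r_t = ∑ x`. [folklore] -/
theorem preSum_add_sufSum (x : Fin n → ℝ) (t : ℕ) : preSum x t + sufSum x t = ∑ i, x i := by
  unfold preSum sufSum
  rw [← Finset.sum_filter_add_sum_filter_not univ (fun i : Fin n ↦ (i : ℕ) < t)]
  congr 2
  ext i
  simp [not_lt]

/-- `r_0 = ∑ x`. [folklore] -/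
theorem sufSum_zero (x : Fin n → ℝ) : sufSum x 0 = ∑ i, x i := by
  simp [sufSum]

/-- `r_t = 0` for `t ≥ n`. [folklore] -/
theorem sufSum_of_le (x : Fin n → ℝ) {t : ℕ} (ht : n ≤ t) : sufSum x t = 0 := by
  unfold sufSum
  rw [Finset.sum_eq_zero]
  intro i hi
  simp only [mem_filter, mem_univ, true_and] at hi
  exact absurd (lt_of_lt_of_le i.isLt (ht.trans hi)) (lt_irrefl _)

/-- `s_t = ∑ x - r_t`. [folklore] -/
theorem preSum_eq (x : Fin n → ℝ) (t : ℕ) : preSum x t = (∑ i, x i) - sufSum x t := by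
  rw [← preSum_add_sufSum x t]
  ring

/-- Dropping the first entry shifts the suffix sums: `r_{t+1}(x) = r_t(x_1, …, x_n)`. [folklore] -/
theorem sufSum_succ (x : Fin (n + 1) → ℝ) (t : ℕ) : sufSum x (t + 1) = sufSum (Fin.tail x) t := by
  unfold sufSum
  rw [Finset.sum_filter, Finset.sum_filter, Fin.sum_univ_succ]
  simp [Fin.tail]

/-- `min_t r_t(x) = min (∑ x, min_t r_t(x_1, …, x_n))`. [folklore] -/
theorem minSuf_succ (x : Fin (n + 1) → ℝ) :
    minSuf x = min (∑ i, x i) (minSuf (Fin.tail x)) := by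
  unfold minSuf
  refine le_antisymm ?_ ?_
  · refine le_min ?_ ?_
    · rw [← sufSum_zero]
      exact Finset.inf'_le _ (by simp)
    · refine Finset.le_inf' _ _ fun t ht ↦ ?_
      rw [← sufSum_succ]
      refine Finset.inf'_le _ ?_
      simp only [mem_range] at ht ⊢
      omega
  · refine Finset.le_inf' _ _ fun t ht ↦ ?_
    rcases t with _ | t
    · rw [sufSum_zero]
      exact min_le_left _ _
    · refine (min_le_right _ _).trans ?_
      rw [sufSum_succ]
      refine Finset.inf'_le _ ?_
      simp only [mem_range] at ht ⊢
      omega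

/-- `min_t r_t ≤ 0` (the empty suffix). [folklore] -/
theorem minSuf_nonpos (x : Fin n → ℝ) : minSuf x ≤ 0 := by
  unfold minSuf
  rw [← sufSum_of_le x le_rfl]
  exact Finset.inf'_le _ (by simp)

/-- If `∑ x ≥ 0` the full suffix does not compete: `min_t r_t(x) = min_t r_t(x_1, …, x_n)`.
[folklore] -/
theorem minSuf_eq_tail_of_nonneg (x : Fin (n + 1) → ℝ) (h : 0 ≤ ∑ i, x i) :
    minSuf x = minSuf (Fin.tail x) := by
  rw [minSuf_succ, min_eq_right]
  exact (minSuf_nonpos _).trans h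

/-- `S(x) = ∑ x - min_t r_t(x)`. [folklore] -/
theorem maxPre_eq_sub_minSuf (x : Fin n → ℝ) : maxPre x = (∑ i, x i) - minSuf x := by
  unfold maxPre minSuf
  refine le_antisymm ?_ ?_
  · refine Finset.sup'_le _ _ fun t ht ↦ ?_
    rw [preSum_eq]
    exact sub_le_sub_left (Finset.inf'_le _ ht) _
  · obtain ⟨t, ht, heq⟩ := Finset.exists_mem_eq_inf' (s := range (n + 1)) ⟨0, by simp⟩ (sufSum x)
    rw [heq, ← preSum_eq]
    exact Finset.le_sup' _ ht

/-- Reversal turns prefix sums into suffix sums: `s_t(x ∘ rev) = r_{n-t}(x)` (`t ≤ n`).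
[folklore] -/
theorem preSum_comp_rev (x : Fin n → ℝ) {t : ℕ} (ht : t ≤ n) :
    preSum (x ∘ Fin.rev) t = sufSum x (n - t) := by
  unfold preSum sufSum
  rw [Finset.sum_filter, Finset.sum_filter,
    ← Equiv.sum_comp Fin.revPerm (fun j : Fin n ↦ if n - t ≤ (j : ℕ) then x j else 0)]
  refine Finset.sum_congr rfl fun i _ ↦ ?_
  simp only [Function.comp_apply, Fin.revPerm_apply]
  have hi := i.isLt
  have : ((i : ℕ) < t) ↔ (n - t ≤ ((Fin.rev i : Fin n) : ℕ)) := by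
    rw [Fin.val_rev]
    omega
  by_cases h : (i : ℕ) < t
  · rw [if_pos h, if_pos (this.1 h)]
  · rw [if_neg h, if_neg (fun h' ↦ h (this.2 h'))]

/-- `S(x ∘ rev) = max_t r_t(x)`. [folklore] -/
theorem maxPre_comp_rev (x : Fin n → ℝ) : maxPre (x ∘ Fin.rev) = maxSuf x := by
  unfold maxPre maxSuf
  refine le_antisymm ?_ ?_
  · refine Finset.sup'_le _ _ fun t ht ↦ ?_
    have ht' : t ≤ n := by simpa [mem_range, Nat.lt_succ_iff] using ht
    rw [preSum_comp_rev x ht']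
    exact Finset.le_sup' (sufSum x) (mem_range.2 (by omega))
  · refine Finset.sup'_le _ _ fun t ht ↦ ?_
    have ht' : t ≤ n := by simpa [mem_range, Nat.lt_succ_iff] using ht
    have : sufSum x t = preSum (x ∘ Fin.rev) (n - t) := by
      rw [preSum_comp_rev x (Nat.sub_le n t)]
      congr 1
      omega
    rw [this]
    exact Finset.le_sup' (preSum (x ∘ Fin.rev)) (mem_range.2 (by omega))

/-- `max_t r_t(x) = -min_t r_t(-x)`. [folklore] -/
theorem maxSuf_eq_neg_minSuf_neg (x : Fin n → ℝ) : maxSuf x = -minSuf (-x) := by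
  have hneg : ∀ t, sufSum (-x) t = -sufSum x t := fun t ↦ by
    simp [sufSum, Finset.sum_neg_distrib]
  unfold maxSuf minSuf
  refine le_antisymm ?_ ?_
  · refine Finset.sup'_le _ _ fun t ht ↦ ?_
    rw [le_neg]
    have := Finset.inf'_le (sufSum (-x)) ht
    rw [hneg] at this
    exact this
  · obtain ⟨t, ht, heq⟩ :=
      Finset.exists_mem_eq_inf' (s := range (n + 1)) ⟨0, by simp⟩ (sufSum (-x))
    rw [heq, hneg, neg_neg]
    exact Finset.le_sup' _ ht

/-! ## Sums over permutations -/

/-- The embedding `i ↦ swap(0, p)(i+1)` of `Fin n` onto the complement of `p` in `Fin (n+1)`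
(the tail of a permutation with first entry `p`, cf. `Equiv.Perm.decomposeFin`). [folklore] -/
def tailEmb (p : Fin (n + 1)) : Fin n ↪ Fin (n + 1) :=
  ⟨fun i ↦ Equiv.swap 0 p i.succ, fun _ _ h ↦ Fin.succ_injective _ ((Equiv.swap 0 p).injective h)⟩

/-- Unfolding `tailEmb`. [folklore] -/
theorem tailEmb_apply (p : Fin (n + 1)) (i : Fin n) : tailEmb p i = Equiv.swap 0 p i.succ := rfl

/-- The image of `tailEmb p` is everything but `p`. [folklore] -/
theorem map_tailEmb_univ (p : Fin (n + 1)) : univ.map (tailEmb p) = univ.erase p := by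
  ext j
  simp only [mem_map, mem_univ, true_and, mem_erase, and_true, tailEmb_apply]
  constructor
  · rintro ⟨i, rfl⟩ h
    have : Equiv.swap (0 : Fin (n + 1)) p i.succ = Equiv.swap (0 : Fin (n + 1)) p 0 := by
      rw [h, Equiv.swap_apply_left]
    exact Fin.succ_ne_zero _ ((Equiv.swap (0 : Fin (n + 1)) p).injective this)
  · intro hj
    have hj0 : Equiv.swap (0 : Fin (n + 1)) p j ≠ 0 := by
      intro h
      have : Equiv.swap (0 : Fin (n + 1)) p j = Equiv.swap (0 : Fin (n + 1)) p p := by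
        rw [h, Equiv.swap_apply_right]
      exact hj ((Equiv.swap (0 : Fin (n + 1)) p).injective this)
    refine ⟨(Equiv.swap 0 p j).pred hj0, ?_⟩
    rw [Fin.succ_pred, Equiv.swap_apply_self]

/-- Decomposing permutations by their first entry: if `∑ x ≥ 0`,
`∑_σ min_t r_t(σx) = ∑_p ∑_{e ∈ S_n} min_t r_t(e(x|_{[n+1]∖p}))`. [folklore] -/
theorem sum_perm_minSuf_succ (x : Fin (n + 1) → ℝ) (h : 0 ≤ ∑ i, x i) :
    ∑ σ : Perm (Fin (n + 1)), minSuf (x ∘ σ) =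
      ∑ p : Fin (n + 1), ∑ e : Perm (Fin n), minSuf ((x ∘ tailEmb p) ∘ e) := by
  rw [← Equiv.sum_comp Equiv.Perm.decomposeFin.symm, Fintype.sum_prod_type]
  refine Finset.sum_congr rfl fun p _ ↦ Finset.sum_congr rfl fun e _ ↦ ?_
  have hsum : 0 ≤ ∑ i, (x ∘ ⇑(Equiv.Perm.decomposeFin.symm (p, e))) i := by
    rw [Function.comp_def, Equiv.sum_comp (Equiv.Perm.decomposeFin.symm (p, e)) x]
    exact h
  rw [minSuf_eq_tail_of_nonneg _ hsum]
  congr 1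
  funext i
  simp [Fin.tail, tailEmb_apply]

/-- Reversal: `∑_σ min_t r_t(σx) = n! ∑x + ∑_σ min_t r_t(-σx)`. [cite: RudnickSarnak1996, (4.37)] -/
theorem sum_perm_minSuf_eq (x : Fin n → ℝ) :
    ∑ σ : Perm (Fin n), minSuf (x ∘ σ) =
      (n.factorial : ℝ) * ∑ i, x i + ∑ σ : Perm (Fin n), minSuf ((-x) ∘ σ) := by
  have h1 : ∀ σ : Perm (Fin n), minSuf (x ∘ σ) = (∑ i, x i) - maxPre (x ∘ σ) := by
    intro σ
    rw [maxPre_eq_sub_minSuf, Function.comp_def, Equiv.sum_comp σ x]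
    ring
  have h2 : ∑ σ : Perm (Fin n), maxPre (x ∘ σ) = -∑ σ : Perm (Fin n), minSuf ((-x) ∘ σ) := by
    rw [← Equiv.sum_comp (Equiv.mulRight Fin.revPerm), ← Finset.sum_neg_distrib]
    refine Finset.sum_congr rfl fun σ _ ↦ ?_
    have : x ∘ ⇑(Equiv.mulRight Fin.revPerm σ) = (x ∘ σ) ∘ Fin.rev := by
      funext i
      simp
    rw [this, maxPre_comp_rev, maxSuf_eq_neg_minSuf_neg]
    rfl
  simp_rw [h1]
  rw [Finset.sum_sub_distrib, Finset.sum_const, Finset.card_univ, Fintype.card_perm,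
    Fintype.card_fin, h2, nsmul_eq_mul]
  ring

/-! ## The closed form -/

/-- Spitzer's weight `(|A| - 1)! (n - |A|)!`: the number of permutations of `[n]` having the
nonempty set `A` as one of their cycles. [cite: Spitzer1956, Thm 2.2] -/
def weight (n : ℕ) (A : Finset (Fin n)) : ℝ := ((#A - 1).factorial * (n - #A).factorial : ℕ)

/-- The closed form `G(x) = ∑_A (|A|-1)!(n-|A|)! (∑_A x)⁻` (so that `∑_σ min_t r_t(σx) = -G(x)`).
[cite: Spitzer1956, Thm 2.2] -/
def closedMinus (x : Fin n → ℝ) : ℝ := ∑ A : Finset (Fin n), weight n A * max (-∑ i ∈ A, x i) 0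

/-- `∑_{A ∋ i} (|A|-1)!(n-|A|)! = n!` for each index `i`. [folklore] -/
theorem sum_weight_filter_mem (i : Fin n) :
    ∑ A ∈ (univ : Finset (Finset (Fin n))).filter (fun A ↦ i ∈ A), weight n A = n.factorial := by
  classical
  have huniv : (univ : Finset (Finset (Fin n))) = (univ : Finset (Fin n)).powerset := by
    ext A; simp
  have hins : (univ : Finset (Fin n)) = insert i (univ.erase i) := by simp
  rw [huniv, Finset.sum_filter, hins, Finset.sum_powerset_insert (notMem_erase i univ)]
  have hzero : ∑ A ∈ (univ.erase i).powerset, (if i ∈ A then weight n A else 0) = 0 := by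
    refine Finset.sum_eq_zero fun A hA ↦ ?_
    rw [if_neg]
    exact fun hi ↦ notMem_erase i univ (mem_powerset.1 hA hi)
  rw [hzero, zero_add]
  have hstep : ∀ A ∈ (univ.erase i).powerset,
      (if i ∈ insert i A then weight n (insert i A) else 0) =
        (((#A).factorial * (n - 1 - #A).factorial : ℕ) : ℝ) := by
    intro A hA
    have hiA : i ∉ A := fun hi ↦ notMem_erase i univ (mem_powerset.1 hA hi)
    rw [if_pos (mem_insert_self i A), weight, card_insert_of_notMem hiA]
    congr 3
    omega
  rw [Finset.sum_congr rfl hstep, Finset.sum_powerset]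
  have hcard : #((univ : Finset (Fin n)).erase i) = n - 1 := by
    rw [card_erase_of_mem (mem_univ i), card_univ, Fintype.card_fin]
  rw [hcard]
  have hlayer : ∀ j ∈ range (n - 1 + 1),
      ∑ A ∈ powersetCard j ((univ : Finset (Fin n)).erase i),
        (((#A).factorial * (n - 1 - #A).factorial : ℕ) : ℝ) = ((n - 1).factorial : ℝ) := by
    intro j hj
    rw [Finset.sum_powersetCard j ((univ : Finset (Fin n)).erase i)
      (fun m ↦ (((m).factorial * (n - 1 - m).factorial : ℕ) : ℝ)), hcard, nsmul_eq_mul]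
    have hjle : j ≤ n - 1 := by simpa [mem_range, Nat.lt_succ_iff] using hj
    rw [← Nat.choose_mul_factorial_mul_factorial hjle]
    push_cast
    ring
  rw [Finset.sum_congr rfl hlayer, Finset.sum_const, card_range, nsmul_eq_mul]
  rcases n with _ | m
  · exact absurd i.isLt (Nat.not_lt_zero _)
  · simp [Nat.factorial_succ]

/-- `∑_A (|A|-1)!(n-|A|)! ∑_{i∈A} x_i = n! ∑ x`. [folklore] -/
theorem sum_weight_mul_sum (x : Fin n → ℝ) :
    ∑ A : Finset (Fin n), weight n A * ∑ i ∈ A, x i = n.factorial * ∑ i, x i := by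
  classical
  have : ∀ A : Finset (Fin n), weight n A * ∑ i ∈ A, x i =
      ∑ i, if i ∈ A then weight n A * x i else 0 := by
    intro A
    rw [Finset.mul_sum, ← Finset.sum_filter]
    congr 1
    ext i; simp
  simp_rw [this]
  rw [Finset.sum_comm, Finset.mul_sum]
  refine Finset.sum_congr rfl fun i _ ↦ ?_
  rw [← Finset.sum_filter]
  have : ∑ A ∈ univ.filter (fun A : Finset (Fin n) ↦ i ∈ A), weight n A * x i =
      (∑ A ∈ univ.filter (fun A : Finset (Fin n) ↦ i ∈ A), weight n A) * x i := by
    rw [Finset.sum_mul]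
  rw [this, sum_weight_filter_mem]

/-- Reversal for the closed form: `-G(x) = n! ∑x - G(-x)`. [folklore] -/
theorem closedMinus_neg (x : Fin n → ℝ) :
    closedMinus (-x) = closedMinus x + n.factorial * ∑ i, x i := by
  unfold closedMinus
  rw [← sum_weight_mul_sum, ← Finset.sum_add_distrib]
  refine Finset.sum_congr rfl fun A _ ↦ ?_
  rw [← mul_add]
  congr 1
  simp only [Pi.neg_apply, Finset.sum_neg_distrib, neg_neg]
  rcases le_total 0 (∑ i ∈ A, x i) with h | h
  · rw [max_eq_left h, max_eq_right (neg_nonpos.2 h), zero_add]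
  · rw [max_eq_right h, max_eq_left (neg_nonneg.2 h)]
    ring

/-- Sums over subsets of an embedded image. [folklore] -/
theorem sum_powerset_map {α β : Type*} [DecidableEq β] (f : α ↪ β) (s : Finset α)
    (Φ : Finset β → ℝ) : ∑ ω ∈ (s.map f).powerset, Φ ω = ∑ ω ∈ s.powerset, Φ (ω.map f) := by
  classical
  rw [Finset.map_eq_image, Finset.powerset_image, Finset.sum_image]
  · exact Finset.sum_congr rfl fun ω _ => by rw [Finset.map_eq_image]
  · intro x _ y _ h
    apply Finset.map_injective f
    rwa [Finset.map_eq_image, Finset.map_eq_image]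

/-- First-entry decomposition for the closed form: if `∑ x ≥ 0` then
`G_{n+1}(x) = ∑_p G_n(x|_{[n+1]∖p})`. [folklore] -/
theorem closedMinus_succ (x : Fin (n + 1) → ℝ) (h : 0 ≤ ∑ i, x i) :
    closedMinus x = ∑ p : Fin (n + 1), closedMinus (x ∘ tailEmb p) := by
  classical
  -- the modified weight `v`
  set v : Finset (Fin (n + 1)) → ℝ :=
    fun A ↦ (((#A - 1).factorial * (n - #A).factorial : ℕ) : ℝ) * max (-∑ i ∈ A, x i) 0 with hv
  -- each inner sum is a sum of `v` over the subsets avoiding `p`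
  have hinner : ∀ p : Fin (n + 1),
      closedMinus (x ∘ tailEmb p) = ∑ A ∈ (univ.erase p).powerset, v A := by
    intro p
    unfold closedMinus
    have huniv : (univ : Finset (Finset (Fin n))) = (univ : Finset (Fin n)).powerset := by
      ext A; simp
    rw [huniv, ← map_tailEmb_univ, sum_powerset_map]
    refine Finset.sum_congr rfl fun B _ ↦ ?_
    simp only [hv, card_map, weight, Function.comp_apply, Finset.sum_map]
  simp_rw [hinner]
  -- swap the sums
  have hswap : ∑ p : Fin (n + 1), ∑ A ∈ (univ.erase p).powerset, v A =
      ∑ A : Finset (Fin (n + 1)), (((n + 1 - #A : ℕ) : ℝ)) * v A := by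
    have : ∀ p : Fin (n + 1), ∑ A ∈ (univ.erase p).powerset, v A =
        ∑ A : Finset (Fin (n + 1)), if p ∉ A then v A else 0 := by
      intro p
      rw [← Finset.sum_filter]
      congr 1
      ext A
      simp only [mem_powerset, mem_filter, mem_univ, true_and]
      constructor
      · intro hA hp
        exact notMem_erase p univ (hA hp)
      · intro hp a ha
        exact mem_erase.2 ⟨fun h ↦ hp (h ▸ ha), mem_univ a⟩
    simp_rw [this]
    rw [Finset.sum_comm]
    refine Finset.sum_congr rfl fun A _ ↦ ?_
    rw [← Finset.sum_filter, Finset.sum_const]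
    have : #(univ.filter (fun p : Fin (n + 1) ↦ p ∉ A)) = n + 1 - #A := by
      have : univ.filter (fun p : Fin (n + 1) ↦ p ∉ A) = Aᶜ := by
        ext p; simp
      rw [this, card_compl, Fintype.card_fin]
    rw [this, nsmul_eq_mul]
  rw [hswap]
  unfold closedMinus
  refine Finset.sum_congr rfl fun A _ ↦ ?_
  by_cases hA : A = univ
  · -- the full set contributes `0` on both sides since `∑ x ≥ 0`
    subst hA
    have : max (-∑ i ∈ (univ : Finset (Fin (n + 1))), x i) 0 = 0 :=
      max_eq_right (neg_nonpos.2 h)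
    simp [hv, this]
  · have hlt : #A < n + 1 := by
      have := card_lt_card (Finset.ssubset_univ_iff.2 hA)
      simpa [card_univ, Fintype.card_fin] using this
    simp only [hv, weight, ← mul_assoc]
    congr 1
    have h1 : n + 1 - #A = (n - #A) + 1 := by omega
    rw [h1, Nat.factorial_succ]
    push_cast
    ring

/-- **The induction.** `∑_σ min_t r_t(σx) = -∑_A (|A|-1)!(n-|A|)! (∑_A x)⁻`.
[cite: Spitzer1956, Thm 2.2] -/
theorem sum_perm_minSuf_eq_neg_closedMinus :
    ∀ {n : ℕ} (x : Fin n → ℝ), ∑ σ : Perm (Fin n), minSuf (x ∘ σ) = -closedMinus x := by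
  intro n
  induction n with
  | zero =>
    intro x
    have hmin : ∀ σ : Perm (Fin 0), minSuf (x ∘ σ) = 0 := by
      intro σ
      unfold minSuf
      have : range (0 + 1) = {0} := by simp
      simp [this, sufSum]
    have hcl : closedMinus x = 0 := by
      unfold closedMinus
      refine Finset.sum_eq_zero fun A _ ↦ ?_
      rw [Finset.eq_empty_of_isEmpty A]
      simp
    simp [hmin, hcl]
  | succ n ih =>
    have key : ∀ x : Fin (n + 1) → ℝ, 0 ≤ ∑ i, x i →
        ∑ σ : Perm (Fin (n + 1)), minSuf (x ∘ σ) = -closedMinus x := by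
      intro x hx
      rw [sum_perm_minSuf_succ x hx, closedMinus_succ x hx, ← Finset.sum_neg_distrib]
      exact Finset.sum_congr rfl fun p _ ↦ ih _
    intro x
    by_cases hx : 0 ≤ ∑ i, x i
    · exact key x hx
    · have hx' : 0 ≤ ∑ i, (-x) i := by
        simp only [Pi.neg_apply, Finset.sum_neg_distrib]
        linarith
      rw [sum_perm_minSuf_eq, key (-x) hx', closedMinus_neg]
      ring

end Spitzer

open Spitzer

/-! ## The theorems -/

/-- **Spitzer's combinatorial lemma, summed form** (Spitzer, Trans. AMS 82 (1956), Theorem 2.2: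
the multisets `{S(σx)}_σ` and `{T(τx)}_τ`, `S(σx) = max(0, max_k (x_{σ1} + ⋯ + x_{σk}))`,
`T(τx) = ∑_{cycles C of τ} (∑_{i∈C} x_i)⁺`, coincide; summing, and counting the
`(|A|-1)!(n-|A|)!` permutations of which a given nonempty `A` is a cycle):
`∑_{σ ∈ S_n} max_{0 ≤ t ≤ n} (x_{σ 0} + ⋯ + x_{σ(t-1)}) = ∑_{A ⊆ [n]} (|A|-1)!(n-|A|)! (∑_{i∈A} x_i)⁺`
(the term `A = ∅` vanishes). This is Rudnick–Sarnak's (4.41). [cite: Spitzer1956, Thm 2.2] -/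
theorem sum_perm_maxPre {n : ℕ} (x : Fin n → ℝ) :
    ∑ σ : Perm (Fin n), maxPre (x ∘ σ) =
      ∑ A : Finset (Fin n), weight n A * max (∑ i ∈ A, x i) 0 := by
  have h1 : ∀ σ : Perm (Fin n), maxPre (x ∘ σ) = (∑ i, x i) - minSuf (x ∘ σ) := by
    intro σ
    rw [maxPre_eq_sub_minSuf, Function.comp_def, Equiv.sum_comp σ x]
  simp_rw [h1]
  rw [Finset.sum_sub_distrib, sum_perm_minSuf_eq_neg_closedMinus, Finset.sum_const,
    Finset.card_univ, Fintype.card_perm, Fintype.card_fin, nsmul_eq_mul, sub_neg_eq_add]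
  unfold closedMinus
  rw [← sum_weight_mul_sum, ← Finset.sum_add_distrib]
  refine Finset.sum_congr rfl fun A _ ↦ ?_
  rw [← mul_add]
  congr 1
  rcases le_total 0 (∑ i ∈ A, x i) with h | h
  · rw [max_eq_left h, max_eq_right (neg_nonpos.2 h), add_zero]
  · rw [max_eq_right h, max_eq_left (neg_nonneg.2 h), add_neg_cancel]

/-- Spitzer's lemma for `x` and `-x` together:
`∑_σ (max_t s_t(σx) + max_t s_t(-σx)) = ∑_A (|A|-1)!(n-|A|)! |∑_{i∈A} x_i|`; here
`max_t s_t(σx) + max_t s_t(-σx) = max_t s_t - min_t s_t` is the spread `V` of the walk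
(Rudnick–Sarnak (4.31)). [cite: Spitzer1956, Thm 2.2] -/
theorem sum_perm_maxPre_add {n : ℕ} (x : Fin n → ℝ) :
    ∑ σ : Perm (Fin n), (maxPre (x ∘ σ) + maxPre ((-x) ∘ σ)) =
      ∑ A : Finset (Fin n), weight n A * |∑ i ∈ A, x i| := by
  rw [Finset.sum_add_distrib, sum_perm_maxPre, sum_perm_maxPre, ← Finset.sum_add_distrib]
  refine Finset.sum_congr rfl fun A _ ↦ ?_
  rw [← mul_add]
  congr 1
  simp only [Pi.neg_apply, Finset.sum_neg_distrib]
  rcases le_total 0 (∑ i ∈ A, x i) with h | h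
  · rw [max_eq_left h, max_eq_right (neg_nonpos.2 h), add_zero, abs_of_nonneg h]
  · rw [max_eq_right h, max_eq_left (neg_nonneg.2 h), zero_add, abs_of_nonpos h]

/-- **Rudnick–Sarnak's spread identity, linear-order form** (Duke Math. J. 81 (1996),
(4.35)–(4.36) with (4.43): `T(u) = (1/n) ∑_O V(O) = ∑_{[F, Fᶜ]} (|F|-1)!(n-|F|-1)! |u_F|` for
`∑ u_i = 0`, the sum over all orderings `O` of `[n]`, `V(O) = M_u(O) - m_u(O)` the spread of the
partial sums (4.29)–(4.31)). Here with both sides multiplied by `n` and the sum over unordered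
pairs `{F, Fᶜ}` written as one half of the sum over all subsets (the terms `F = ∅, [n]` vanish):
if `∑ x_i = 0` then
`∑_{σ ∈ S_n} (max_t s_t(σx) - min_t s_t(σx)) = (n/2) ∑_{A ⊆ [n]} (|A|-1)!(n-|A|-1)! |∑_{i∈A} x_i|`.
Proof: `sum_perm_maxPre_add` and the pairing `A ↔ Aᶜ` ((4.42) loc. cit.).
[cite: RudnickSarnak1996, (4.35)–(4.43)] -/
theorem sum_perm_spread_eq {n : ℕ} (x : Fin n → ℝ) (hx : ∑ i, x i = 0) :
    ∑ σ : Perm (Fin n), (maxPre (x ∘ σ) + maxPre ((-x) ∘ σ)) =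
      (n : ℝ) / 2 * ∑ A : Finset (Fin n),
        (((#A - 1).factorial * (n - #A - 1).factorial : ℕ) : ℝ) * |∑ i ∈ A, x i| := by
  classical
  rw [sum_perm_maxPre_add]
  -- the symmetric weight `c(A) = (|A|-1)!(n-|A|-1)! |x(A)|`
  set c : Finset (Fin n) → ℝ :=
    fun A ↦ (((#A - 1).factorial * (n - #A - 1).factorial : ℕ) : ℝ) * |∑ i ∈ A, x i| with hc
  have hcompl_sum : ∀ A : Finset (Fin n), ∑ i ∈ Aᶜ, x i = -∑ i ∈ A, x i := by
    intro A
    have := Finset.sum_compl_add_sum A x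
    linarith
  have hcsymm : ∀ A : Finset (Fin n), c Aᶜ = c A := by
    intro A
    simp only [hc, hcompl_sum, abs_neg, card_compl, Fintype.card_fin]
    by_cases hA0 : A = ∅
    · subst hA0
      simp
    by_cases hA1 : A = univ
    · subst hA1
      simp [hx]
    have hpos : 0 < #A := card_pos.2 (nonempty_iff_ne_empty.2 hA0)
    have hlt : #A < n := by
      have := card_lt_card (Finset.ssubset_univ_iff.2 hA1)
      simpa [card_univ, Fintype.card_fin] using this
    congr 2
    rw [mul_comm]
    congr 2
    omega
  -- both sides in terms of `c`
  have hL : ∀ A : Finset (Fin n), weight n A * |∑ i ∈ A, x i| = ((n - #A : ℕ) : ℝ) * c A := by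
    intro A
    by_cases hA1 : A = univ
    · subst hA1
      simp [hc, weight, hx]
    have hlt : #A < n := by
      have := card_lt_card (Finset.ssubset_univ_iff.2 hA1)
      simpa [card_univ, Fintype.card_fin] using this
    simp only [hc, weight, ← mul_assoc]
    congr 1
    have h1 : n - #A = (n - #A - 1) + 1 := by omega
    rw [h1, Nat.factorial_succ]
    push_cast
    ring
  simp_rw [hL]
  rw [Finset.mul_sum]
  -- `S = ∑ c(A) (n - |A| - n/2)` vanishes by the involution `A ↦ Aᶜ`
  have hS : ∑ A : Finset (Fin n), c A * (((n - #A : ℕ) : ℝ) - n / 2) =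
      ∑ A : Finset (Fin n), c A * ((#A : ℝ) - n / 2) := by
    refine Finset.sum_nbij' (fun A ↦ Aᶜ) (fun A ↦ Aᶜ) (by simp) (by simp) (by simp) (by simp) ?_
    intro A _
    rw [hcsymm, card_compl, Fintype.card_fin]
  have hS0 : ∑ A : Finset (Fin n), c A * (((n - #A : ℕ) : ℝ) - n / 2) = 0 := by
    have h2 : 2 * ∑ A : Finset (Fin n), c A * (((n - #A : ℕ) : ℝ) - n / 2) = 0 := by
      rw [two_mul]
      nth_rewrite 2 [hS]
      rw [← Finset.sum_add_distrib]
      refine Finset.sum_eq_zero fun A _ ↦ ?_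
      have : #A ≤ n := by simpa [card_univ, Fintype.card_fin] using card_le_univ A
      push_cast [this]
      ring
    linarith
  have : ∀ A : Finset (Fin n), ((n - #A : ℕ) : ℝ) * c A =
      (n : ℝ) / 2 * c A + c A * (((n - #A : ℕ) : ℝ) - n / 2) := by
    intro A; ring
  rw [Finset.sum_congr rfl (fun A _ ↦ this A), Finset.sum_add_distrib, hS0, add_zero]

end Literature.Combinatorics.Enumerative

end
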